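import Summits.Ventures.YMGap.RobustBall.TermPerturbation
import HarnessLib

/-!
# RobustBall/ClassFunctionTerm — the CLASS-FUNCTION local term `f(U_w)` of a closed word, and `λ ≥ 0` on `SU(N)`
(cell `pub-ymgap`, track Y2 ROBUST-BALL, plaquette rung T0.6; ds-4, on p1's generic layer `LoopWords` /
`LoopActivity` / `TermPerturbation`)

HONEST FRAMING: venture file, finite-torus bookkeeping only (no continuum, no Clay claim).

For a density `f : SU(N) → ℝ` and a word `w` the activity `classActivity f w U = f(U_w)` (`U_w = wordProd w U`):
it reads only the links of `w`; it is measurable for continuous `f`; it is GAUGE INVARIANT when `w` is a closed walk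
and `f` is a class function (`f(hgh⁻¹) = f(g)`, via `wordProd_gaugeTransform`); it is invariant under centre-slab
rotations when `w` is balanced (`wordProd_centerSlabRotate_of_balanced`); its single-link oscillation is
`≤ a₀ · mult_w(e)` when `f x − f y ≤ a₀`, and its single-link Frobenius-Lipschitz constant is `≤ λ · mult_w(e)` when
`|f x − f y| ≤ λ‖x − y‖_F`, `λ ≥ 0` (`suFrobDist_wordProd_le_mult`).  Packaged: `LocalTerm.ofClass` (constants
`oscC = a₀`, `lipC = λ`, bound `|f 1| + a₀`) — the class-function sibling of p1's `LocalTerm.ofLoop`.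

Also: on `SU(N)`, `N ≥ 2`, the centre element `e^{2πi/N}·1` is at positive Frobenius distance from `1`, so a
Frobenius-Lipschitz constant is automatically `≥ 0` (`lipschitz_const_nonneg`) — used by `PlaquetteMember` to run the
typed target `PlaquetteMemberTargetC` (which quantifies `λ` freely) for every `N ≥ 2`.
-/

noncomputable section

open MeasureTheory Finset Function
open Literature.Probability.LatticeModels Literature.Probability.LatticeModels.DobrushinMetric
open Literature.MathematicalPhysics.QuantumLattice hiding torusNorm
open Literature.MathematicalPhysics.QuantumFieldTheory hiding ZdEdge

namespace Summit.Ventures.YMGap.RobustBall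

variable {d L N : ℕ}

/-! ### Class-function activities of a word -/

/-- The activity `U ↦ f(U_w)` of the word `w` with density `f`. [folklore] -/
def classActivity (f : SUN N → ℝ) (w : List (Letter d L)) (U : GaugeConfig d L (SUN N)) : ℝ :=
  f (wordProd w U)

/-- `U ↦ f(U_w)` reads only the links of `w`. [folklore] -/
theorem dependsOn_classActivity (f : SUN N → ℝ) (w : List (Letter d L)) :
    DependsOn (classActivity f w) (↑(wordEdges w) : Set (Edge d L)) :=
  fun _ _ h => congrArg f (dependsOn_wordProd w h)

/-- `U ↦ f(U_w)` is measurable for continuous `f`. [folklore] -/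
theorem measurable_classActivity {f : SUN N → ℝ} (hf : Continuous f) (w : List (Letter d L)) :
    Measurable (classActivity (d := d) (L := L) f w) :=
  hf.measurable.comp (measurable_wordProd w)

/-- `U ↦ f(U_w)` is gauge invariant for a CLOSED walk `w` and a CLASS function `f`. [folklore] -/
theorem isGaugeInvariant_classActivity {f : SUN N → ℝ} (hfconj : ∀ g h : SUN N, f (h * g * h⁻¹) = f g)
    {w : List (Letter d L)} {s : Site d L} (hw : IsWalk s w s) : IsGaugeInvariant (classActivity f w) := by
  intro g U
  unfold classActivity
  rw [wordProd_gaugeTransform hw, hfconj]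

/-- A function of oscillation `≤ a₀` is bounded by `|f 1| + a₀`. [folklore] -/
theorem abs_le_of_osc {f : SUN N → ℝ} {a₀ : ℝ} (hfosc : ∀ x y, f x - f y ≤ a₀) (g : SUN N) :
    |f g| ≤ |f 1| + a₀ := by
  have h1 := hfosc g 1
  have h2 := hfosc 1 g
  rw [abs_le]
  constructor
  · linarith [neg_abs_le (f 1)]
  · linarith [le_abs_self (f 1)]

/-- Single-link oscillation witness of `U ↦ f(U_w)`: `a₀ · mult_w(e)` (`a₀ ≥ osc f`). [folklore] -/
theorem isOscBound_classActivity {f : SUN N → ℝ} {a₀ : ℝ} (hfosc : ∀ x y, f x - f y ≤ a₀) (w : List (Letter d L)) :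
    Dobrushin.IsOscBound (classActivity (d := d) (L := L) f w) fun e => a₀ * mult w e := by
  have ha0 : 0 ≤ a₀ := by simpa using hfosc 1 1
  refine ⟨fun e => by positivity, fun y U V h => ?_⟩
  rcases Nat.eq_zero_or_pos (mult w y) with hm | hm
  · have : classActivity f w U = classActivity f w V :=
      dependsOn_classActivity f w fun e he => h e fun hey => by
        rw [hey] at he; exact (mult_eq_zero_iff.1 hm) he
    rw [this, sub_self, abs_zero]; positivity
  · have hle : |classActivity f w U - classActivity f w V| ≤ a₀ := by
      have h3 := hfosc (wordProd w U) (wordProd w V)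
      have h4 := hfosc (wordProd w V) (wordProd w U)
      rw [abs_le]
      unfold classActivity
      constructor <;> linarith
    have : (1 : ℝ) ≤ mult w y := by exact_mod_cast hm
    nlinarith

/-- Single-link Frobenius-Lipschitz witness of `U ↦ f(U_w)`: `λ · mult_w(e)` (`0 ≤ λ`, `Lip_F f ≤ λ`). [folklore] -/
theorem isLipBound_classActivity {f : SUN N → ℝ} {lam : ℝ} (hlam : 0 ≤ lam)
    (hflip : ∀ x y, |f x - f y| ≤ lam * suFrobDist x y) (w : List (Letter d L)) :
    IsLipBound suFrobDist (classActivity (d := d) (L := L) f w) fun e => lam * mult w e := by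
  refine ⟨fun e => by positivity, fun y U V h => ?_⟩
  calc |f (wordProd w U) - f (wordProd w V)| ≤ lam * suFrobDist (wordProd w U) (wordProd w V) := hflip _ _
    _ ≤ lam * (mult w y * suFrobDist (U y) (V y)) :=
        mul_le_mul_of_nonneg_left (suFrobDist_wordProd_le_mult w h) hlam
    _ = lam * mult w y * suFrobDist (U y) (V y) := by ring

/-- `U ↦ f(U_w)` is invariant under centre-slab rotations when `w` is BALANCED. [folklore] -/
theorem classActivity_centerSlabRotate (f : SUN N → ℝ) {w : List (Letter d L)} (hw : ∀ v t, netCount w v t = 0)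
    (v : Fin d) (t : ZMod L) {z : SUN N} (hz : z ∈ Subgroup.center (SUN N)) (U : GaugeConfig d L (SUN N)) :
    classActivity f w (centerSlabRotate v t z U) = classActivity f w U := by
  unfold classActivity
  rw [wordProd_centerSlabRotate_of_balanced hw v t hz]

/-- **The class-function term** of a closed word `w` based at `x₀` with letters based in `code`: activity `f(U_w)`,
constants `oscC = a₀`, `lipC = λ`, bound `|f 1| + a₀`. [folklore] -/
def LocalTerm.ofClass (f : SUN N → ℝ) (a₀ lam : ℝ) (hf : Continuous f)
    (hfconj : ∀ g h : SUN N, f (h * g * h⁻¹) = f g) (hfosc : ∀ x y, f x - f y ≤ a₀) (hlam : 0 ≤ lam)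
    (hflip : ∀ x y, |f x - f y| ≤ lam * suFrobDist x y) (w : List (Letter d L)) (code : Finset (Site d L))
    (x₀ : Site d L) (hw : IsWalk x₀ w x₀) (hcode : ∀ l ∈ w, l.site ∈ code) : LocalTerm d L N where
  act := classActivity f w
  letters := w
  code := code
  site_mem := hcode
  dependsOn := dependsOn_classActivity f w
  gaugeInvariant := isGaugeInvariant_classActivity hfconj hw
  measurable := measurable_classActivity hf w
  bound := |f 1| + a₀
  abs_le U := abs_le_of_osc hfosc (wordProd w U)
  oscC := a₀
  lipC := lam
  isOscBound := isOscBound_classActivity hfosc w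
  isLipBound := isLipBound_classActivity hlam hflip w

/-! ### `λ ≥ 0` on `SU(N)` for `N ≥ 2` -/

/-- For `N ≥ 2` the centre element `e^{2πi/N}·1` of `SU(N)` lies at POSITIVE Frobenius distance from `1`. [folklore] -/
theorem suFrobDist_centre_one_pos (hN : 2 ≤ N) : 0 < suFrobDist (DurhuusFrohlich.centre N (by omega)) 1 := by
  have hN0 : N ≠ 0 := by omega
  have hroot : DurhuusFrohlich.rootOfUnity N ≠ 1 := (Complex.isPrimitiveRoot_exp N hN0).ne_one hN
  set k : Fin N := ⟨0, by omega⟩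
  have hle := norm_entry_le_frobNorm
    (((DurhuusFrohlich.centre N hN0 : SUN N) : Matrix (Fin N) (Fin N) ℂ) - ((1 : SUN N) : Matrix (Fin N) (Fin N) ℂ)) k k
  have hkk : (((DurhuusFrohlich.centre N hN0 : SUN N) : Matrix (Fin N) (Fin N) ℂ) -
      ((1 : SUN N) : Matrix (Fin N) (Fin N) ℂ)) k k = DurhuusFrohlich.rootOfUnity N - 1 := by
    show (DurhuusFrohlich.rootOfUnity N • (1 : Matrix (Fin N) (Fin N) ℂ) - 1) k k = _
    simp
  rw [hkk] at hle
  exact (norm_pos_iff.2 (sub_ne_zero.2 hroot)).trans_le hle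

/-- On `SU(N)`, `N ≥ 2`, a Frobenius-Lipschitz constant is nonnegative. [folklore] -/
theorem lipschitz_const_nonneg (hN : 2 ≤ N) {f : SUN N → ℝ} {lam : ℝ}
    (hflip : ∀ x y, |f x - f y| ≤ lam * suFrobDist x y) : 0 ≤ lam := by
  have hD := suFrobDist_centre_one_pos hN
  have h0 := (abs_nonneg _).trans (hflip (DurhuusFrohlich.centre N (by omega)) 1)
  by_contra hneg
  exact absurd (mul_neg_of_neg_of_pos (not_le.1 hneg) hD) (not_lt.2 h0)

end Summit.Ventures.YMGap.RobustBall

end
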